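import Summits.MatrixMultiplication.MatrixMultiplication.Theorems.SaturationLadderUniformDefect
import Summits.MatrixMultiplication.MatrixMultiplication.Theorems.SaturationLadderTwinSaturation
import HarnessLib

/-!
# Saturation ladder — Kernel XXV-A: windows and the explicit onset of the twin family

Cell `decomp-mm`, lens `decomp-mm-lens-1` (grading / quantitative ladder), gen 53; supports the
deciding crux `SubexpSaturation` (item 25909) of `route-MatrixMultiplication-SaturationLadder`.
No new hypotheses, no `sorry`.  Companion: Kernel XXV-B `SaturationLadderUniformWindowRung` (the
first uniform rung below `log 4`).

Kernel XXIV graded the SUMMIT by the uniform defect ladder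
`U(C) :⟺ ∀ t ∈ [0,1), ∃ r ∈ [1, e^{C/(1−t)}], ω(1,t,r) ≤ 1 + r` (`⟺ Δ ≤ C` on `[1,∞)`,
`Δ(r) = (1 − τ_ℂ(r))·log r`; `ω = 2 ⟺ ∀ C > 0, U(C)`) and proved its sharp level-1 rung `U(log 4)`.
Every rung BELOW `log 4` is "an eventual clause with an EXPLICIT onset + finitely many mid-range
certificates"; this kernel supplies both halves of that sentence as theorems.

* §1 WINDOWS.  An eventual clause at rate `c` with explicit onset `t₀` bounds the defect beyond an
  explicit length: `Δ(r) ≤ c` for all `r ≥ e^{c/(1−t₀)}` (`defect_le_beyond_onset`); hence for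
  `C ≥ c` the rung `U(C)` is DECIDED on the bounded window `r ∈ [1, e^{C/(1−t₀)}]`
  (`uniformClause_iff_window`), and a window certificate glues to the clause
  (`uniformClause_of_window`).
* §2 THE EXPLICIT ONSET OF THE TWIN FAMILY.  The stage-2 family `(t_j, r_j)` of Kernels XIX–XXI
  (`SaturationLadderTwinFamily*`: `1 − t_j = (47j+37)/((j+1)(30j+37))`, `r_j ≤ 2^{j+1}`) yields the
  clause at rate `c` from the explicit onset `t_{j₀}` as soon as its `Y`-entropy inequality holds
  from `j₀ ≥ 64` and `(j+2)(47j+37)·log 2 ≤ c·(j+1)(30j+37)` for `j ≥ j₀`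
  (`twinClause_explicit_of_familyY`; rate `1.1` from any `j₀ ≥ 64`: `twinClause_eleven_tenths`).
  Unconditionally (`familyY`, `j₀ = 1000`): the clause at `c = 1.087` from
  `T⋆ = t_{1000} = 1 − 47037/30067037 ≈ 0.99844` (`twinClause_explicit` — the rung
  `TwinSaturation`/`c₂` of piece 1 with its onset made explicit), hence
  **`Δ(r) ≤ 1.087` for every `r ≥ e^{695}`** (`defect_le_of_exp_le`) and, for every `C ≥ 1.087`,
  **`U(C) ⟺ Δ(r) ≤ C` for `r ∈ [1, e^{C·30067037/47037}]`** (`uniformClause_iff_window_twin`):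
  each uniform rung down to `1.087` is a statement about a BOUNDED range of shapes.

[novel: the window reduction with explicit onsets and the explicit twin clause are this lineage's;
the twin family is Coppersmith–Winograd 1990 §8 / Alman et al. 2025 §3.4 as typed in Kernels
XIX–XXI; the frontier and its threshold property are Kernel XXII.]
-/


set_option linter.dupNamespace false

namespace Summit.MatrixMultiplication.MatrixMultiplication.Theorems.SaturationLadderUniformWindow

open Literature.Computability.AlgebraicComplexity
open Summit.MatrixMultiplication.MatrixMultiplication.Theses.SaturationLadder
open Summit.MatrixMultiplication.MatrixMultiplication.Theorems.SaturationLadderTowerLimit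
open Summit.MatrixMultiplication.MatrixMultiplication.Theorems.SaturationLadderExpSaturation
open Summit.MatrixMultiplication.MatrixMultiplication.Theorems.SaturationLadderFrontierDefect
open Summit.MatrixMultiplication.MatrixMultiplication.Theorems.SaturationLadderUniformDefect
open Summit.MatrixMultiplication.MatrixMultiplication.Theorems.SaturationLadderTwinExact
open Summit.MatrixMultiplication.MatrixMultiplication.Theorems.SaturationLadderTwinFamily
open Summit.MatrixMultiplication.MatrixMultiplication.Theorems.SaturationLadderTwinFamilyX
open Summit.MatrixMultiplication.MatrixMultiplication.Theorems.SaturationLadderTwinSaturation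

noncomputable section

/-! ## §1 Windows: an explicit onset reduces `U(C)` to a bounded range of lengths -/

/-- **Gluing a window to an eventual clause.**  If the clause at rate `c` holds from the onset `t₀`
and the window `[0, t₀)` is certified at rate `C ≥ c`, then `U(C)`. [folklore] -/
theorem uniformClause_of_window {c C t₀ : ℝ} (hcC : c ≤ C)
    (hev : ∀ t : ℝ, t₀ ≤ t → t < 1 → ∃ r : ℝ, 1 ≤ r ∧ r ≤ Real.exp (c / (1 - t)) ∧
      omegaRect ℂ 1 t r ≤ 1 + r)
    (hwin : ∀ t : ℝ, 0 ≤ t → t < t₀ → ∃ r : ℝ, 1 ≤ r ∧ r ≤ Real.exp (C / (1 - t)) ∧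
      omegaRect ℂ 1 t r ≤ 1 + r) :
    ∀ t : ℝ, 0 ≤ t → t < 1 → ∃ r : ℝ, 1 ≤ r ∧ r ≤ Real.exp (C / (1 - t)) ∧
      omegaRect ℂ 1 t r ≤ 1 + r := by
  intro t ht0 ht1
  rcases lt_or_ge t t₀ with h | h
  · exact hwin t ht0 h
  · obtain ⟨r, h1, h2, h3⟩ := hev t h ht1
    exact ⟨r, h1, h2.trans (Real.exp_le_exp.2 (div_le_div_of_nonneg_right hcC (by linarith))), h3⟩

/-- **Explicit onset ⟹ explicit defect bound.**  If the clause at rate `c > 0` holds from the onset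
`t₀ < 1`, then `Δ(r) = (1 − τ_ℂ(r))·log r ≤ c` for every `r ≥ e^{c/(1−t₀)}` (take `t = 1 − c/log r`,
which lies in `[t₀, 1)`). [folklore] -/
theorem defect_le_beyond_onset {c t₀ : ℝ} (hc : 0 < c) (ht₀ : t₀ < 1)
    (hev : ∀ t : ℝ, t₀ ≤ t → t < 1 → ∃ r : ℝ, 1 ≤ r ∧ r ≤ Real.exp (c / (1 - t)) ∧
      omegaRect ℂ 1 t r ≤ 1 + r) :
    ∀ r : ℝ, Real.exp (c / (1 - t₀)) ≤ r →
      (1 - sSup {t : ℝ | omegaRect ℂ 1 t r ≤ 1 + r}) * Real.log r ≤ c := by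
  intro r hr
  have h1t₀ : 0 < 1 - t₀ := by linarith
  have hct : 0 < c / (1 - t₀) := div_pos hc h1t₀
  have hr1 : 1 < r := by
    have := Real.add_one_le_exp (c / (1 - t₀))
    linarith
  have hr0 : 0 ≤ r := by linarith
  have hlog : 0 < Real.log r := Real.log_pos hr1
  have hlogge : c / (1 - t₀) ≤ Real.log r := by
    have := Real.log_le_log (Real.exp_pos _) hr
    rwa [Real.log_exp] at this
  set t : ℝ := 1 - c / Real.log r with htdef
  have hcle : c / Real.log r ≤ 1 - t₀ := by
    rw [div_le_iff₀ hlog]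
    have := (div_le_iff₀ h1t₀).1 hlogge
    linarith
  have ht₀t : t₀ ≤ t := by rw [htdef]; linarith
  have ht1 : t < 1 := by
    have : 0 < c / Real.log r := div_pos hc hlog
    rw [htdef]; linarith
  obtain ⟨r', -, hr'le, hT⟩ := hev t ht₀t ht1
  have e1t : 1 - t = c / Real.log r := by rw [htdef]; ring
  have he : Real.exp (c / (1 - t)) = r := by
    rw [e1t, div_div_cancel₀ hc.ne', Real.exp_log (by linarith)]
  rw [he] at hr'le
  have hτ := (tight_iff_le_frontier hr0 t).1 (thinTight_of_len_le ℂ hr'le hT)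
  have e : (1 - t) * Real.log r = c := by
    rw [e1t]
    exact div_mul_cancel₀ c hlog.ne'
  have : (1 - sSup {t : ℝ | omegaRect ℂ 1 t r ≤ 1 + r}) * Real.log r ≤ (1 - t) * Real.log r :=
    mul_le_mul_of_nonneg_right (by linarith) hlog.le
  linarith

/-- **`U(C)` is decided on a bounded window.**  Given the clause at rate `c > 0` from an explicit
onset `t₀ < 1` and `C ≥ c`:  `U(C) ⟺ Δ(r) ≤ C` for all `r ∈ [1, e^{C/(1−t₀)}]`. [folklore] -/
theorem uniformClause_iff_window {c C t₀ : ℝ} (hc : 0 < c) (hcC : c ≤ C) (ht₀ : t₀ < 1)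
    (hev : ∀ t : ℝ, t₀ ≤ t → t < 1 → ∃ r : ℝ, 1 ≤ r ∧ r ≤ Real.exp (c / (1 - t)) ∧
      omegaRect ℂ 1 t r ≤ 1 + r) :
    (∀ t : ℝ, 0 ≤ t → t < 1 → ∃ r : ℝ, 1 ≤ r ∧ r ≤ Real.exp (C / (1 - t)) ∧
      omegaRect ℂ 1 t r ≤ 1 + r) ↔
    ∀ r : ℝ, 1 ≤ r → r ≤ Real.exp (C / (1 - t₀)) →
      (1 - sSup {t : ℝ | omegaRect ℂ 1 t r ≤ 1 + r}) * Real.log r ≤ C := by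
  have hC : 0 < C := hc.trans_le hcC
  rw [uniformClause_iff_defect hC]
  refine ⟨fun h r hr _ => h r hr, fun h r hr => ?_⟩
  rcases le_or_gt r (Real.exp (C / (1 - t₀))) with hle | hgt
  · exact h r hr hle
  · have hge : Real.exp (c / (1 - t₀)) ≤ r :=
      (Real.exp_le_exp.2 (div_le_div_of_nonneg_right hcC (by linarith))).trans hgt.le
    exact (defect_le_beyond_onset hc ht₀ hev r hge).trans hcC

/-! ## §2 The explicit clause of the stage-2 twin family -/

/-- `r_j ≤ 2^{j+1} = e^{(j+1) log 2} ≤ e^y` once `(j+1)·log 2 ≤ y` (`j ≥ 2`). [folklore] -/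
theorem fR_le_exp {j : ℕ} (hj : 2 ≤ j) {y : ℝ} (hy : ((j : ℝ) + 1) * Real.log 2 ≤ y) :
    fR j ≤ Real.exp y := by
  have e : (2 : ℝ) ^ (j + 1) = Real.exp (((j : ℝ) + 1) * Real.log 2) := by
    have ek : ((j : ℝ) + 1) = ((j + 1 : ℕ) : ℝ) := by push_cast; ring
    rw [ek, Real.exp_nat_mul, Real.exp_log two_pos]
  calc fR j ≤ (2 : ℝ) ^ (j + 1) := fR_le j hj
    _ = Real.exp (((j : ℝ) + 1) * Real.log 2) := e
    _ ≤ Real.exp y := Real.exp_le_exp.2 hy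

/-- The abscissae `t_{j₀+k}` exhaust `[0,1)` (`1 − t_j ≤ 2/j`). [folklore] -/
theorem exists_le_fT (j₀ : ℕ) (hj₀ : 1 ≤ j₀) {s : ℝ} (hs : s < 1) :
    ∃ k : ℕ, s ≤ fT (j₀ + k) := by
  obtain ⟨k, hk⟩ := exists_nat_ge (2 / (1 - s))
  refine ⟨k, ?_⟩
  have h1s : 0 < 1 - s := by linarith
  have hjpos : (0 : ℝ) < ((j₀ + k : ℕ) : ℝ) := by
    have : (1 : ℝ) ≤ ((j₀ + k : ℕ) : ℝ) := by exact_mod_cast (by omega : 1 ≤ j₀ + k)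
    linarith
  have hle := one_sub_fT_le (j₀ + k) (by omega)
  have hk' : 2 / (1 - s) ≤ ((j₀ + k : ℕ) : ℝ) :=
    hk.trans (by push_cast; linarith [(Nat.cast_nonneg j₀ : (0 : ℝ) ≤ j₀)])
  have h2 : 2 / ((j₀ + k : ℕ) : ℝ) ≤ 1 - s := by
    rw [div_le_iff₀ hjpos]
    have := (div_le_iff₀ h1s).1 hk'
    linarith
  linarith

/-- **Rate step.**  If `t ≥ t_m` and `(m+2)(47m+37)·log 2 ≤ c·(m+1)(30m+37)`, then
`(m+2)·log 2 ≤ c/(1−t)` (`1/(1−t) ≥ 1/(1−t_m) = (m+1)(30m+37)/(47m+37)`). [folklore] -/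
theorem rate_of_le {m : ℕ} {c t : ℝ} (ht1 : t < 1) (hmt : fT m ≤ t)
    (hcm : ((m : ℝ) + 2) * (47 * m + 37) * Real.log 2 ≤ c * (((m : ℝ) + 1) * (30 * m + 37))) :
    ((m : ℝ) + 2) * Real.log 2 ≤ c / (1 - t) := by
  have h1t : 0 < 1 - t := by linarith
  have hM : (0 : ℝ) ≤ m := Nat.cast_nonneg _
  have hl0 : 0 < Real.log 2 := Real.log_pos one_lt_two
  have hD : (0 : ℝ) < ((m : ℝ) + 1) * (30 * m + 37) := by positivity
  have h1 : 1 - t ≤ (47 * (m : ℝ) + 37) / (((m : ℝ) + 1) * (30 * m + 37)) := by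
    rw [← one_sub_fT m]; linarith
  rw [le_div_iff₀ h1t]
  have h2 : ((m : ℝ) + 2) * Real.log 2 * (1 - t) ≤
      ((m : ℝ) + 2) * Real.log 2 * ((47 * (m : ℝ) + 37) / (((m : ℝ) + 1) * (30 * m + 37))) :=
    mul_le_mul_of_nonneg_left h1 (by positivity)
  have h3 : ((m : ℝ) + 2) * Real.log 2 * ((47 * (m : ℝ) + 37) / (((m : ℝ) + 1) * (30 * m + 37)))
      ≤ c := by
    rw [← mul_div_assoc, div_le_iff₀ hD]
    linarith
  exact h2.trans h3

/-- **The explicit clause of the twin family.**  If the `Y`-entropy inequality of the stage-2 family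
holds from `j₀ ≥ 64` and `(j+2)(47j+37)·log 2 ≤ c·(j+1)(30j+37)` for all `j ≥ j₀`, then for every
`t ∈ [t_{j₀}, 1)` some `r ∈ [1, e^{c/(1−t)}]` has `ω(1,t,r) ≤ 1 + r`: for `t ∈ (t_{j}, t_{j+1}]` the
member `j+1` (`r_{j+1} ≤ 2^{j+2} ≤ e^{c/(1−t_j)} ≤ e^{c/(1−t)}`), each member being tight by the exact
six-type theorem `omegaRect_one_tw_exact` (`X`-inequality: `familyX`).
[cite: CoppersmithWinograd1990, §8] [cite: AlmanDuanVassilevskaWilliamsXuXuZhou2025, §3.4] -/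
theorem twinClause_explicit_of_familyY (j₀ : ℕ) (hj₀ : 64 ≤ j₀)
    (hY : ∀ j : ℕ, j₀ ≤ j →
      shannonEntropy
          ![((fN₁ j : ℝ) + fN₄ j + (0 : ℕ)) / (fN₁ j + fN₂ j + fN₃ j + fN₄ j + 0 + fN₆ j : ℕ),
          ((fN₂ j : ℝ) + fN₃ j) / (fN₁ j + fN₂ j + fN₃ j + fN₄ j + 0 + fN₆ j : ℕ),
          (fN₆ j : ℝ) / (fN₁ j + fN₂ j + fN₃ j + fN₄ j + 0 + fN₆ j : ℕ)] ≤
        shannonEntropy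
          ![((fN₃ j : ℝ) + (0 : ℕ) + fN₆ j) / (fN₁ j + fN₂ j + fN₃ j + fN₄ j + 0 + fN₆ j : ℕ),
          ((fN₁ j : ℝ) + fN₂ j) / (fN₁ j + fN₂ j + fN₃ j + fN₄ j + 0 + fN₆ j : ℕ),
          (fN₄ j : ℝ) / (fN₁ j + fN₂ j + fN₃ j + fN₄ j + 0 + fN₆ j : ℕ)])
    {c : ℝ}
    (hc : ∀ j : ℕ, j₀ ≤ j →
      ((j : ℝ) + 2) * (47 * j + 37) * Real.log 2 ≤ c * (((j : ℝ) + 1) * (30 * j + 37))) :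
    ∀ t : ℝ, fT j₀ ≤ t → t < 1 →
      ∃ r : ℝ, 1 ≤ r ∧ r ≤ Real.exp (c / (1 - t)) ∧ omegaRect ℂ 1 t r ≤ 1 + r := by
  classical
  intro t ht ht1
  have hcert : ∀ j : ℕ, j₀ ≤ j → omegaRect ℂ 1 (fT j) (fR j) ≤ 1 + fR j := fun j hj =>
    omegaRect_one_tw_exact j (fN₁ j) (fN₂ j) (fN₃ j) (fN₄ j) 0 (fN₆ j) (by unfold fN₆; omega)
      (fN₁_add_fN₄ j (by omega)) (fN₂_add_fN₃ j (by omega)) (by unfold fN₃; positivity)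
      (familyX j (by omega)) (hY j hj)
  have hex : ∃ k : ℕ, t ≤ fT (j₀ + k) := exists_le_fT j₀ (by omega) ht1
  have hspec := Nat.find_spec hex
  refine ⟨fR (j₀ + Nat.find hex), one_le_fR _ (by omega), ?_,
    thinTight_of_le ℂ hspec (hcert _ (by omega))⟩
  have hl0 : 0 < Real.log 2 := Real.log_pos one_lt_two
  rcases Nat.eq_zero_or_pos (Nat.find hex) with h0 | hpos
  · -- `t = t_{j₀}`: the member `j₀` itself
    rw [h0, add_zero]
    have hrate := rate_of_le ht1 ht (hc j₀ le_rfl)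
    exact fR_le_exp (by omega) (by nlinarith)
  · obtain ⟨k, hk⟩ : ∃ k, Nat.find hex = k + 1 := ⟨Nat.find hex - 1, by omega⟩
    have hlt : fT (j₀ + k) < t := by
      have := Nat.find_min hex (show k < Nat.find hex by omega)
      exact lt_of_not_ge this
    rw [hk]
    have hrate := rate_of_le ht1 hlt.le (hc (j₀ + k) (by omega))
    refine fR_le_exp (by omega) ?_
    have e : (((j₀ + (k + 1) : ℕ) : ℝ) + 1) = ((j₀ + k : ℕ) : ℝ) + 2 := by push_cast; ring
    rw [e]
    exact hrate

/-- Numerics: `(j+2)(47j+37)·log 2 ≤ 1.1·(j+1)(30j+37)` for `j ≥ 64`. [folklore] -/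
theorem rate_ineq_eleven_tenths (j : ℕ) (hj : 64 ≤ j) :
    ((j : ℝ) + 2) * (47 * j + 37) * Real.log 2 ≤ 1.1 * (((j : ℝ) + 1) * (30 * j + 37)) := by
  have hJ : (64 : ℝ) ≤ j := by exact_mod_cast hj
  have hl := Real.log_two_lt_d9
  have hq : (0 : ℝ) ≤ ((j : ℝ) + 2) * (47 * j + 37) := by positivity
  have h1 : ((j : ℝ) + 2) * (47 * j + 37) * Real.log 2 ≤
      ((j : ℝ) + 2) * (47 * j + 37) * 0.6931471808 := mul_le_mul_of_nonneg_left hl.le hq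
  nlinarith [mul_nonneg (sub_nonneg.2 hJ) (Nat.cast_nonneg j : (0 : ℝ) ≤ j)]

/-- Numerics: `(j+2)(47j+37)·log 2 ≤ 1.087·(j+1)(30j+37)` for `j ≥ 1000`. [folklore] -/
theorem rate_ineq_1087 (j : ℕ) (hj : 1000 ≤ j) :
    ((j : ℝ) + 2) * (47 * j + 37) * Real.log 2 ≤ 1.087 * (((j : ℝ) + 1) * (30 * j + 37)) := by
  have hJ : (1000 : ℝ) ≤ j := by exact_mod_cast hj
  have hl := Real.log_two_lt_d9
  have hq : (0 : ℝ) ≤ ((j : ℝ) + 2) * (47 * j + 37) := by positivity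
  have h1 : ((j : ℝ) + 2) * (47 * j + 37) * Real.log 2 ≤
      ((j : ℝ) + 2) * (47 * j + 37) * 0.6931471808 := mul_le_mul_of_nonneg_left hl.le hq
  nlinarith [mul_nonneg (sub_nonneg.2 hJ) (Nat.cast_nonneg j : (0 : ℝ) ≤ j)]

/-- **The twin clause at rate `1.1` from any `Y`-threshold `j₀ ≥ 64`.**
[cite: CoppersmithWinograd1990, §8] [cite: AlmanDuanVassilevskaWilliamsXuXuZhou2025, §3.4] -/
theorem twinClause_eleven_tenths (j₀ : ℕ) (hj₀ : 64 ≤ j₀)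
    (hY : ∀ j : ℕ, j₀ ≤ j →
      shannonEntropy
          ![((fN₁ j : ℝ) + fN₄ j + (0 : ℕ)) / (fN₁ j + fN₂ j + fN₃ j + fN₄ j + 0 + fN₆ j : ℕ),
          ((fN₂ j : ℝ) + fN₃ j) / (fN₁ j + fN₂ j + fN₃ j + fN₄ j + 0 + fN₆ j : ℕ),
          (fN₆ j : ℝ) / (fN₁ j + fN₂ j + fN₃ j + fN₄ j + 0 + fN₆ j : ℕ)] ≤
        shannonEntropy
          ![((fN₃ j : ℝ) + (0 : ℕ) + fN₆ j) / (fN₁ j + fN₂ j + fN₃ j + fN₄ j + 0 + fN₆ j : ℕ),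
          ((fN₁ j : ℝ) + fN₂ j) / (fN₁ j + fN₂ j + fN₃ j + fN₄ j + 0 + fN₆ j : ℕ),
          (fN₄ j : ℝ) / (fN₁ j + fN₂ j + fN₃ j + fN₄ j + 0 + fN₆ j : ℕ)]) :
    ∀ t : ℝ, fT j₀ ≤ t → t < 1 →
      ∃ r : ℝ, 1 ≤ r ∧ r ≤ Real.exp (1.1 / (1 - t)) ∧ omegaRect ℂ 1 t r ≤ 1 + r :=
  twinClause_explicit_of_familyY j₀ hj₀ hY fun j hj => rate_ineq_eleven_tenths j (by omega)

/-- **THE EXPLICIT TWIN CLAUSE (unconditional).**  For every `t ∈ [T⋆, 1)`,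
`T⋆ = t_{1000} = 1 − 47037/30067037 ≈ 0.998436`, some `r ∈ [1, e^{1.087/(1−t)}]` has
`ω(1,t,r) ≤ 1 + r` (the rung `TwinSaturation`/`c₂` of piece 1 with its onset made explicit).
[cite: CoppersmithWinograd1990, §8] [cite: AlmanDuanVassilevskaWilliamsXuXuZhou2025, Thm. 3.2, §3.4] -/
theorem twinClause_explicit :
    ∀ t : ℝ, fT 1000 ≤ t → t < 1 →
      ∃ r : ℝ, 1 ≤ r ∧ r ≤ Real.exp (1.087 / (1 - t)) ∧ omegaRect ℂ 1 t r ≤ 1 + r :=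
  twinClause_explicit_of_familyY 1000 (by norm_num) (fun j hj => familyY j hj)
    fun j hj => rate_ineq_1087 j hj

/-- `1 − T⋆ = 1 − t_{1000} = 47037/30067037`. [folklore] -/
theorem one_sub_fT_thousand : 1 - fT 1000 = 47037 / 30067037 := by
  rw [one_sub_fT]; norm_num

/-- **Explicit eventual defect bound: `Δ(r) ≤ 1.087` for every `r ≥ e^{695}`**
(`e^{1.087/(1−T⋆)} = e^{1.087·30067037/47037} ≤ e^{695}`). [folklore] -/
theorem defect_le_of_exp_le {r : ℝ} (hr : Real.exp 695 ≤ r) :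
    (1 - sSup {t : ℝ | omegaRect ℂ 1 t r ≤ 1 + r}) * Real.log r ≤ 1.087 := by
  refine defect_le_beyond_onset (by norm_num) (fT_lt_one 1000) twinClause_explicit r (le_trans ?_ hr)
  apply Real.exp_le_exp.2
  rw [one_sub_fT_thousand]; norm_num

/-- **The window form of every rung `C ≥ 1.087`:**  `U(C) ⟺ Δ(r) ≤ C` for all
`r ∈ [1, e^{C/(1−T⋆)}] = [1, e^{C·30067037/47037}]`. [folklore] -/
theorem uniformClause_iff_window_twin {C : ℝ} (hC : 1.087 ≤ C) :
    (∀ t : ℝ, 0 ≤ t → t < 1 → ∃ r : ℝ, 1 ≤ r ∧ r ≤ Real.exp (C / (1 - t)) ∧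
      omegaRect ℂ 1 t r ≤ 1 + r) ↔
    ∀ r : ℝ, 1 ≤ r → r ≤ Real.exp (C / (1 - fT 1000)) →
      (1 - sSup {t : ℝ | omegaRect ℂ 1 t r ≤ 1 + r}) * Real.log r ≤ C :=
  uniformClause_iff_window (by norm_num) hC (fT_lt_one 1000) twinClause_explicit

end

end Summit.MatrixMultiplication.MatrixMultiplication.Theorems.SaturationLadderUniformWindow
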